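import Mathlib.LinearAlgebra.Eigenspace.Basic
import Literature.NumberTheory.LFunctions.ZetaScrewHermitianForms
import Literature.NumberTheory.ConnesConsani2021.ArchimedeanTraceFormula
import HarnessLib

/-!
# Suzuki's integral operator `𝖦_g[a]` is of trace class (Thm. 1.5) — STATEMENTS

LINE 1 — LABEL: RH-FREE corpus literature (two NAMED FACTS `def … : Prop`, printed
"unconditionally"; nothing about RH is asserted). bears_on: LADDER-RH B-C/B-P (COLUMN 6 DBR) —
record only. WHAT THIS IS NOT: not a route, not a proof plan for RH; the trace-class property of
`𝖦_g[a]` holds whether or not RH does (source, §1: "the traceability of `𝖦_g[a]` does not depend on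
the definiteness of `𝖦_g[a]`"); nothing here bears on the truth of RH.

Source: M. Suzuki, *Aspects of the screw function corresponding to the Riemann zeta-function*,
J. Lond. Math. Soc. (2) 108 (2023) 1448–1487 = arXiv:2206.03682v4 [bib: `Suzuki2023`], Thm. 1.5
(held text `paper:arxiv-2206.03682` p0003:L108–110) and the trace formula displayed after it
(p0003:L112–118); proof §6.1 (p0016). Sibling of `ZetaScrewHermitianForms.lean` (the objects
`zetaScrewOp` = (1.12), `zetaScrewForm` = (1.10)); kept apart so that only this module carries the
operator-theory import of the tree's trace-class predicate
`Literature.NumberTheory.ConnesConsani2021.IsTraceClass` (s-number form `Σ_n a_n(T) < ∞`,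
`ArchimedeanTraceFormula.lean`; on a Hilbert space the approximation numbers are the singular
values, so this IS the Schatten class `𝓛¹`) — CITED, not restated.

## What is printed, and how it is typed

* Thm. 1.5: "For each `0 < a < ∞`, `𝖦_g[a]` is a trace class operator unconditionally", where
  `𝖦_g[a] : L²(−a,a) → L²(−a,a)`, `φ(t) ↦ 𝟏_{[−a,a]}(t) ∫_{−a}^{a} G_g(t,u) φ(u) du` ((1.12); "a
  self-adjoint Hilbert–Schmidt operator", §5 p. 15). `L²(−a,a)` = `Lp ℂ 2 (volume.restrict (Ioo (−a) a))`;
  the statement says: there is a bounded operator `T` on it realising (1.12) — `T φ = zetaScrewOp (Ioo (−a) a) φ`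
  a.e. for every `φ` (such a `T` is unique) — and `T` is of trace class: `Suzuki2023_thm15`.
* The display after Thm. 1.5: "`Tr 𝖦_g[a] = Σ_{n≥1} λ_{a,n} = ∫_{−a}^{a} G_g(t,t) dt` holds by
  [GGK01, Ch. IV, Thm. 8.1], where `λ_{a,1}, λ_{a,2}, …` are the non-zero eigenvalues of `𝖦_g[a]`
  counting with multiplicity": `Suzuki2023_thm15_trace` — for the operator `T` realising (1.12), the
  family `μ ↦ (dim ker(T − μ))·μ` over the non-zero eigenvalues is summable with sum
  `∫_{(−a,a)} G_g(t,t) dt` (`= 2∫Ψ`, `zetaScrewKernel_self`). Multiplicity = `Module.finrank` of the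
  eigenspace (`T` is self-adjoint, so geometric = algebraic; compact, so every non-zero eigenspace is
  finite-dimensional — no `finrank` junk).

Printed proof of Thm. 1.5 (§6.1, for the record; nothing of it is formalised here): split
`g = g₀ + g₁ + g_∞` by (4.8); Lipschitz kernels are trace class [GGK01, Ch. IV Thm. 8.2]; for
`g_{∞,1}(t) = 2|t| log(1/|t|)` use [GoKr69, p. 120] (a Hilbert–Schmidt kernel whose `∂/∂u` in the mean
is Hilbert–Schmidt is trace class). FACT-LIST boundary candidates (Mathlib has no trace ideals):
these two operator-theory inputs.
-/

noncomputable section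

open MeasureTheory Set
open scoped ComplexConjugate ComplexOrder

namespace Literature.NumberTheory.LFunctions

/-- RH-FREE (printed "unconditionally"). **Suzuki2023 Thm. 1.5.** "For each `0 < a < ∞`, `𝖦_g[a]`
is a trace class operator unconditionally": the integral operator (1.12) is (realised by) a bounded
operator `T` on `L²(−a,a)` — `T φ = 𝖦_g[a]φ` a.e. for every `φ` — and `T` is of trace class
(`Literature.NumberTheory.ConnesConsani2021.IsTraceClass`: summable approximation numbers = singular
values). Such a `T` is unique. Printed proof §6.1: split `g = g₀ + g₁ + g_∞`; Lipschitz kernels are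
trace class [GGK01, IV Thm. 8.2]; the `2|t|log(1/|t|)` part by [GoKr69, p. 120]. [cite: Suzuki2023, Thm 1.5, p. 3 (held text p0003:L108–110)] -/
def Suzuki2023_thm15 : Prop :=
  ∀ a : ℝ, 0 < a →
    ∃ T : Lp ℂ 2 (volume.restrict (Ioo (-a) a)) →L[ℂ] Lp ℂ 2 (volume.restrict (Ioo (-a) a)),
      (∀ φ : Lp ℂ 2 (volume.restrict (Ioo (-a) a)),
        (T φ : ℝ → ℂ) =ᵐ[volume.restrict (Ioo (-a) a)] zetaScrewOp (Ioo (-a) a) φ) ∧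
      ConnesConsani2021.IsTraceClass T


/-- RH-FREE. **The trace formula displayed after Thm. 1.5**: "Since `𝖦_g[a]` is a trace class operator,
`Tr 𝖦_g[a] = Σ_{n≥1} λ_{a,n} = ∫_{−a}^{a} G_g(t,t) dt` holds by [GGK01, Ch. IV, Thm. 8.1], where
`λ_{a,1}, λ_{a,2}, …` are the non-zero eigenvalues of `𝖦_g[a]` counting with multiplicity." Typed for
the bounded operator `T` realising (1.12) on `L²(−a,a)` (it exists and is unique by Thm. 1.5): the
family `μ ↦ (dim ker(T − μ)) · μ` over the non-zero eigenvalues `μ` is summable with sum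
`∫_{−a}^{a} G_g(t,t) dt` (`= 2∫_{−a}^{a} Ψ`, `zetaScrewKernel_self`). `T` is self-adjoint (real
symmetric kernel), so geometric = algebraic multiplicity, and compact, so each non-zero eigenspace is
finite-dimensional (`Module.finrank` carries no junk here). [cite: Suzuki2023, §1 display after Thm 1.5, p. 3 (held text p0003:L112–118)] -/
def Suzuki2023_thm15_trace : Prop :=
  ∀ a : ℝ, 0 < a →
    ∀ T : Lp ℂ 2 (volume.restrict (Ioo (-a) a)) →L[ℂ] Lp ℂ 2 (volume.restrict (Ioo (-a) a)),
      (∀ φ : Lp ℂ 2 (volume.restrict (Ioo (-a) a)),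
        (T φ : ℝ → ℂ) =ᵐ[volume.restrict (Ioo (-a) a)] zetaScrewOp (Ioo (-a) a) φ) →
      HasSum
        (fun μ : {μ : ℂ // μ ≠ 0 ∧
            Module.End.HasEigenvalue (T : Lp ℂ 2 (volume.restrict (Ioo (-a) a)) →ₗ[ℂ]
              Lp ℂ 2 (volume.restrict (Ioo (-a) a))) μ} ↦
          (Module.finrank ℂ
              (Module.End.eigenspace (T : Lp ℂ 2 (volume.restrict (Ioo (-a) a)) →ₗ[ℂ]
                Lp ℂ 2 (volume.restrict (Ioo (-a) a))) (μ : ℂ)) : ℂ) * (μ : ℂ))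
        (∫ t in Ioo (-a) a, (zetaScrewKernel t t : ℂ))


end Literature.NumberTheory.LFunctions

end
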